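import Literature.NumberTheory.PAdicHodge.DeRhamInductionDescent
import Literature.NumberTheory.GaloisRepresentations.LabelledWeightsBlockSum
import Literature.NumberTheory.GaloisRepresentations.PinnedLabelsAbove
import Literature.NumberTheory.GaloisRepresentations.PinnedLabelledWeightsRestrictField
import HarnessLib

/-!
# Labelled Hodge–Tate weights of an induced de Rham representation
# (Patrikis 2019, Lemma 7.2.1: `HT_{(v,τ)}(Ind_{Γ_E}^{Γ_K} W) = Σ_i HT_{(w_i,σ_i)}(W)`)

Topic `NumberTheory/PAdicHodge`.  PROOF FILE (theorems only: no definition, no named fact, no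
instance; D-0026), for THE pinned Fontaine data `fontainePstAdicCompletion` of the summit.

For number fields `K ⊆ E` with `[E : K] = d`, a framed `W : Γ_E → GL_n(ℚ̄_ℓ)` which is de Rham at
every place of `E` above `ℓ`, a place `v ∣ ℓ` of `K` and a pinned label `τ` of `K` at `v`:
**there are `d` labels `(w_i, σ_i)` of `E` above `(v, τ)`** (`σ_i.emb ∘ (K → E) = τ.emb`, pairwise
distinct global embeddings `E → ℚ̄_ℓ`) **with
`HT_{(v,τ)}(Ind_{Γ_E}^{Γ_K} W) = Σ_i HT_{(w_i,σ_i)}(W)`** as multisets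
(`labelledHodgeTateWeightsAtLabel_induce_of_isDeRhamFramed`).  This is the de Rham case of the
tree's named fact `PAdicHodge.LabelledWeightsInduceSchema` (same three clauses); by
`PinnedLabel.range_emb_eq_of_labels_above` the family `(σ_i)` is, up to relabelling, THE set of
embeddings of `E` extending `τ.emb`, so the right-hand side does not depend on the choices.

## The argument (Patrikis, proof of Lemma 7.2.1, made explicit on frames)

Let `L` be the Galois closure of `E/K` in `K̄` and `r_1, …, r_d` the coset representatives of
`Γ_K / res(Γ_E)` used by `FramedGaloisRep.induce`.  For each `i` there are an embedding
`ε_i : E → L` with `λ ∘ ε_i = r_i ∘ ε` on `K̄` (`exists_ringHom_absEmbedding_eq_smul`) — so `ε_i` is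
`K`-linear, and `ε_i ≠ ε_j` for `i ≠ j` since `r_j⁻¹ r_i ∉ res(Γ_E)`
(`mem_range_absGaloisRestrict_iff_smul_absEmbedding`) — and `t_i ∈ Γ_E` with
`r_i⁻¹ res_{L/K}(σ) r_i = res_{E/K}(t_i res_{L/E,ε_i}(σ) t_i⁻¹)`
(`exists_conj_absGaloisRestrict_eq_of_absEmbedding_eq`).  Hence `(Ind W)|_{Γ_L}` is block diagonal ON
THE NOSE with blocks `V_i = W(t_i) (W|_{Γ_L,ε_i}) W(t_i)⁻¹` (`induce_apply_coe_of_forall_conj_mem`).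
Pick a label `(u, υ)` of `L` above `(v, τ)` (`PinnedLabel.exists_labels_above`).  Then

* `HT_{(v,τ)}(Ind W) = HT_{(u,υ)}((Ind W)|_{Γ_L})` — labelled weights restrict label by label, with
  no hypothesis (`labelledHodgeTateWeightsAtLabel_restrictField_of_emb_comp_eq`; Fontaine Exp. III
  §3, Brinon–Conrad Prop. 6.3.8);
* `HT_{(u,υ)}((Ind W)|_{Γ_L}) = Σ_i HT_υ(V_i|_{Γ_{L_u}})` — additivity over block sums
  (`PeriodRingData.labelledHodgeTateWeights_blockDiagonal`, Fontaine Exp. III Prop. 1.5.2), which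
  needs `dim_{ℚ̄_ℓ} D_υ(V_i) < ∞`: here from de Rham-ness of the blocks (`W` de Rham above `ℓ` ⇒
  `W|_{Γ_L,ε_i}` de Rham at `u`, `isDeRhamFramed_toLocal_restrictField`, ⇒ `V_i` de Rham,
  `isDeRhamFramed_conj_iff`; `fontainePst_finiteDimensional_labelD_and_finrank_eq`);
* `HT_υ(V_i|_{Γ_{L_u}}) = HT_{(u,υ)}(W|_{Γ_L,ε_i}) = HT_{(w_i,σ_i)}(W)` with
  `(w_i, σ_i) = (u ∩_{ε_i} 𝓞 E, υ ∘ ε_i)` the label of `E` below `(u, υ)` along `ε_i` — frame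
  invariance (`PstWeilDeligneData.labelledHodgeTateWeights_conj_eq`) and label-wise restriction
  again (`labelledHodgeTateWeightsAtLabel_restrictField_below`).

The labels `(w_i, σ_i)` lie above `(v, τ)` because `ε_i` is `K`-linear and `(u, υ)` lies above
`(v, τ)`, and their embeddings `υ.emb ∘ ε_i` are pairwise distinct because the `ε_i` are.

The unconditional named fact (no de Rham hypothesis) additionally needs the finite-dimensionality of
`D_υ` of the non-de-Rham blocks over `ℚ̄_ℓ`, i.e. a finite `ℚ_ℓ`-model of `W` (Baire category on the
compact image); that existence theorem is not in the tree, whence the hypothesis `hW` here — the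
case of the summit's consumers (automorphic, hence de Rham, `W`).

## References

* [Patrikis2019] S. Patrikis, *Variations on a theorem of Tate*, Mem. AMS 258 (2019)
  (arXiv:1207.6724), §2.7.1 (labelled weights for `ℚ̄_ℓ`-coefficients) and Lemma 7.2.1 with its
  proof (`D_dR(Ind W)` is `D_dR(W)` with the `E`-structure forgotten).
* [FontaineAsterisque223III] J.-M. Fontaine, *Représentations p-adiques semi-stables*, Astérisque
  223 (1994), Exp. III §1.5 (Prop. 1.5.2: sub-objects, quotients, direct sums) and §3 (base change).
* [BrinonConrad2009] O. Brinon, B. Conrad, *CMI Summer School notes on p-adic Hodge theory*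
  (2009), Prop. 6.3.8 (insensitivity of the de Rham property and of `D_dR` to finite extension of
  the base field).
* [SerreAbelianLadic1968] J.-P. Serre, *Abelian ℓ-adic representations and elliptic curves* (1968),
  Ch. I §2.1 (restriction), Ch. II §3.1 (embeddings above a place).
* [NeukirchANT1999] J. Neukirch, *Algebraic Number Theory* (1999), Ch. II (8.1)–(8.3) (extensions of
  an embedding to a finite extension; places above).
-/

noncomputable section

open scoped NumberField MatrixGroups Matrix
open NumberField IsDedekindDomain Field
open Literature.NumberTheory.Automorphic Literature.NumberTheory.PAdicHodge

/-! ### §1 The block embeddings `ε_i : E → L` are `K`-linear and pairwise distinct -/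

namespace Literature.NumberTheory.GaloisRepresentations

section Embeddings

variable {K E L : Type*} [Field K] [Field E] [Field L] [Algebra K E] [Algebra K L]
  [Algebra.IsAlgebraic K E] [Algebra.IsAlgebraic K L]

/-- **`λ⁻¹ ∘ r ∘ ε : E → L` is `K`-linear**: an embedding `i : E → L` with `λ ∘ i = r ∘ ε` on the
copies `ε(E), λ(L) ⊆ K̄` (`absEmbedding`) for some `r ∈ Γ_K` commutes with the structure maps from
`K`, since `Γ_K` fixes `K`. [cite: MilneFT2022, Ch. 7 (the absolute Galois group)]
[cite: NeukirchANT1999, Ch. II (8.1)] -/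
theorem ringHom_comp_algebraMap_of_absEmbedding_eq_smul (r : absoluteGaloisGroup K) (i : E →+* L)
    (hi : ∀ x, absEmbedding K L (i x) = r • absEmbedding K E x) :
    i.comp (algebraMap K E) = algebraMap K L := by
  refine RingHom.ext fun k => (absEmbedding K L).toRingHom.injective ?_
  change absEmbedding K L (i (algebraMap K E k)) = absEmbedding K L (algebraMap K L k)
  rw [hi, AlgHom.commutes, AlgHom.commutes, absoluteGaloisGroup.smul_def, AlgEquiv.commutes]

/-- **Embeddings `E → L` attached to `r₁, r₂ ∈ Γ_K` coincide only if `r₂⁻¹ r₁ ∈ res(Γ_E)`**, i.e.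
only if `r₁, r₂` lie in the same coset of `res_{E/K}(Γ_E) = Gal(K̄/ε(E))`
(`mem_range_absGaloisRestrict_iff_smul_absEmbedding`). [cite: MilneFT2022, Ch. 7]
[cite: NeukirchANT1999, Ch. II (8.1)] -/
theorem inv_mul_mem_range_absGaloisRestrict_of_absEmbedding_eq_smul (r₁ r₂ : absoluteGaloisGroup K)
    (i₁ i₂ : E →+* L) (h₁ : ∀ x, absEmbedding K L (i₁ x) = r₁ • absEmbedding K E x)
    (h₂ : ∀ x, absEmbedding K L (i₂ x) = r₂ • absEmbedding K E x) (h : i₁ = i₂) :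
    r₂⁻¹ * r₁ ∈ (absGaloisRestrict K E).range := by
  rw [mem_range_absGaloisRestrict_iff_smul_absEmbedding]
  intro x
  rw [mul_smul, ← h₁, h, h₂, inv_smul_smul]

end Embeddings

end Literature.NumberTheory.GaloisRepresentations

/-! ### §2 The induction formula for labelled Hodge–Tate weights (de Rham case) -/

namespace Literature.NumberTheory.PAdicHodge

open Literature.NumberTheory.GaloisRepresentations

/-- **`HT_{(v,τ)}(Ind_{Γ_E}^{Γ_K} W) = Σ_i HT_{(w_i,σ_i)}(W)` for de Rham `W`, THE pinned Fontaine
data** (Patrikis 2019, Lemma 7.2.1 and its proof: `D_dR(Ind W) = D_dR(W)` with the `E ⊗ ℚ̄_ℓ`-module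
structure restricted to `K ⊗ ℚ̄_ℓ`, so the `τ`-labelled graded piece of `Ind W` is the sum of the
`σ`-labelled graded pieces of `W` over the embeddings `σ` of `E` extending `τ`).  For number fields
`K ⊆ E` with `[E : K] = d`, a framed `W : Γ_E → GL_n(ℚ̄_ℓ)` de Rham at every place of `E` above `ℓ`,
a place `v ∣ ℓ` of `K` and a pinned label `τ` at `v`: there are `d` labels `(w_i, σ_i)` of `E` above
`(v, τ)` with pairwise distinct global embeddings such that
`HT_{(v,τ)}(Ind W) = Σ_i HT_{(w_i,σ_i)}(W)`.  See the module docstring for the proof (Galois closure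
`L`, block decomposition of `(Ind W)|_{Γ_L}`, additivity over blocks, frame invariance, label-wise
restriction twice).
[cite: Patrikis2019, §2.7.1 and Lemma 7.2.1 (numbering of arXiv:1207.6724)]
[cite: FontaineAsterisque223III, Exp. III Prop. 1.5.2 and §3] [cite: BrinonConrad2009, Prop. 6.3.8]
[cite: NeukirchANT1999, Ch. II (8.1)–(8.3)] -/
theorem labelledHodgeTateWeightsAtLabel_induce_of_isDeRhamFramed (K E : Type) [Field K]
    [NumberField K] [Field E] [NumberField E] [Algebra K E] (d : ℕ) (hd : Module.finrank K E = d)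
    (ℓ : ℕ) [Fact ℓ.Prime] (n : ℕ) (W : FramedGaloisRep E (PadicAlgCl ℓ) n)
    (hW : ∀ (w : HeightOneSpectrum (𝓞 E)) (hw : ((ℓ : ℕ) : 𝓞 E) ∈ w.asIdeal),
      (fontainePstAdicCompletion w ℓ hw).IsDeRhamFramed (W.toLocal w))
    (v : HeightOneSpectrum (𝓞 K)) (hv : ((ℓ : ℕ) : 𝓞 K) ∈ v.asIdeal) (τ : PinnedLabel ℓ v hv) :
    ∃ (w : Fin d → HeightOneSpectrum (𝓞 E)) (hw : ∀ i, ((ℓ : ℕ) : 𝓞 E) ∈ (w i).asIdeal)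
      (σ : ∀ i, PinnedLabel ℓ (w i) (hw i)),
      (∀ i, (σ i).emb.comp (algebraMap K E) = τ.emb) ∧
      (Function.Injective fun i => (σ i).emb) ∧
      labelledHodgeTateWeightsAtLabel (W.induce K hd) v hv τ =
        ∑ i, labelledHodgeTateWeightsAtLabel W (w i) (hw i) (σ i) := by
  classical
  -- the Galois closure of `E/K` inside `K̄`
  let Lf : IntermediateField K (AlgebraicClosure K) :=
    IntermediateField.normalClosure K E (AlgebraicClosure K)
  haveI : NumberField Lf := NumberField.of_module_finite K Lf
  -- every conjugate of `ε(E)` lies in `λ(L) = L`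
  have hcl : ∀ (r : absoluteGaloisGroup K) (x : E),
      ∃ y : Lf, absEmbedding K Lf y = r • absEmbedding K E x := by
    intro r x
    have hx : absEmbedding K E x ∈ Lf := (absEmbedding K E).fieldRange_le_normalClosure ⟨x, rfl⟩
    have hrx : r • absEmbedding K E x ∈ Lf := by
      refine (IntermediateField.normal_iff_forall_map_le'.1 (normalClosure.normal K E _)
        (absoluteGaloisGroup.toAlgEquiv K r)) ?_
      exact (IntermediateField.mem_map _).2 ⟨_, hx, rfl⟩
    rw [← AlgHom.fieldRange_of_normal (absEmbedding K Lf)] at hrx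
    exact AlgHom.mem_fieldRange.1 hrx
  -- the embeddings `εᵢ : E → L` (`λ ∘ εᵢ = rᵢ ∘ ε`) and the frame changes `tᵢ` at the coset
  -- representatives `rᵢ`
  choose ε hε using fun i : Fin d =>
    exists_ringHom_absEmbedding_eq_smul (L := Lf) (absGaloisCosetRep K E hd i) (hcl _)
  have ht₀ : ∀ i : Fin d, ∃ t : absoluteGaloisGroup E, ∀ σ : absoluteGaloisGroup Lf,
      (absGaloisCosetRep K E hd i)⁻¹ * absGaloisRestrict K Lf σ * absGaloisCosetRep K E hd i =
        absGaloisRestrict K E (t * @absGaloisRestrict E Lf _ _ (ε i).toAlgebra σ * t⁻¹) := fun i => by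
    letI : Algebra E Lf := (ε i).toAlgebra
    exact exists_conj_absGaloisRestrict_eq_of_absEmbedding_eq (K := K) (E := E) (L := Lf)
      (absGaloisCosetRep K E hd i) (hε i)
  choose t ht using ht₀
  -- the blocks `Vᵢ = W(tᵢ) (W|_{Γ_L, εᵢ}) W(tᵢ)⁻¹`
  let V : Fin d → FramedGaloisRep Lf (PadicAlgCl ℓ) n := fun i =>
    FramedRep.conj (W (t i)) (W.comp (@absGaloisRestrict E Lf _ _ (ε i).toAlgebra))
  have hV : ∀ (i : Fin d) (σ : absoluteGaloisGroup Lf),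
      V i σ = W (t i * @absGaloisRestrict E Lf _ _ (ε i).toAlgebra σ * (t i)⁻¹) := fun i σ => by
    change FramedRep.conj (W (t i)) (W.comp (@absGaloisRestrict E Lf _ _ (ε i).toAlgebra)) σ = _
    rw [FramedRep.conj_apply, map_mul, map_mul, map_inv]
    rfl
  -- `(Ind W)|_{Γ_L}` is block diagonal with blocks `Vᵢ`, at every place `u` of `L`
  have hshape : ∀ (u : HeightOneSpectrum (𝓞 Lf)) (g : absoluteGaloisGroup (u.adicCompletion Lf)),
      (((((W.induce K hd).restrictField Lf).toLocal u) g : GL (Fin (d * n)) (PadicAlgCl ℓ)) :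
          Matrix (Fin (d * n)) (Fin (d * n)) (PadicAlgCl ℓ)) =
        Matrix.reindex finProdFinEquiv finProdFinEquiv
          (Matrix.comp (Fin d) (Fin d) (Fin n) (Fin n) (PadicAlgCl ℓ)
            (Matrix.diagonal fun i =>
              (((V i).toLocal u g : GL (Fin n) (PadicAlgCl ℓ)) : Matrix (Fin n) (Fin n) (PadicAlgCl ℓ)))) := by
    intro u g
    set σ := absGaloisRestrict Lf (u.adicCompletion Lf) g with hσ
    have hmem : ∀ i : Fin d, (absGaloisCosetRep K E hd i)⁻¹ * absGaloisRestrict K Lf σ *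
        absGaloisCosetRep K E hd i ∈ (absGaloisRestrict K E).range := fun i => ⟨_, (ht i σ).symm⟩
    have hblocks : (fun i : Fin d => dotExtend (absGaloisRestrict K E).toMonoidHom
        (FramedRep.toMatrixHom W)
        ((absGaloisCosetRep K E hd i)⁻¹ * absGaloisRestrict K Lf σ * absGaloisCosetRep K E hd i)) =
        fun i => (((V i).toLocal u g : GL (Fin n) (PadicAlgCl ℓ)) :
          Matrix (Fin n) (Fin n) (PadicAlgCl ℓ)) := by
      funext i
      rw [FramedGaloisRep.dotExtend_eq_of_eq_absGaloisRestrict K W (ht i σ), FramedGaloisRep.toLocal_apply,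
        ← hσ, hV]
    rw [FramedGaloisRep.toLocal_apply, ← hσ, FramedGaloisRep.restrictField_apply,
      FramedGaloisRep.induce_apply_coe_of_forall_conj_mem K hd W _ hmem, hblocks]
  -- the `εᵢ` are `K`-linear and pairwise distinct
  have hεK : ∀ i, (ε i).comp (algebraMap K E) = algebraMap K Lf := fun i =>
    ringHom_comp_algebraMap_of_absEmbedding_eq_smul _ _ (hε i)
  have hεinj : Function.Injective ε := by
    intro i j hij
    have hmem : (absGaloisCosetRep K E hd j)⁻¹ * absGaloisCosetRep K E hd i ∈
        (absGaloisRestrict K E).range :=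
      inv_mul_mem_range_absGaloisRestrict_of_absEmbedding_eq_smul _ _ _ _ (hε i) (hε j) hij
    have hq : (absGaloisCosetRep K E hd j : absoluteGaloisGroup K ⧸ (absGaloisRestrict K E).range) =
        (absGaloisCosetRep K E hd i : absoluteGaloisGroup K ⧸ (absGaloisRestrict K E).range) :=
      QuotientGroup.eq.mpr hmem
    exact ((absGaloisCosetRep_bijective K E hd).1 hq).symm
  -- a label `(u, υ)` of `L` above `(v, τ)`
  have hLpos : 0 < Module.finrank K Lf := Module.finrank_pos
  obtain ⟨uL, huL, υL, hυL, -, -, -⟩ :=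
    PinnedLabel.exists_labels_above (K := K) (E := Lf) (ℓ := ℓ) rfl τ
  set u : HeightOneSpectrum (𝓞 Lf) := uL ⟨0, hLpos⟩ with hu_def
  have hu : ((ℓ : ℕ) : 𝓞 Lf) ∈ u.asIdeal := huL ⟨0, hLpos⟩
  set υ : PinnedLabel ℓ u hu := υL ⟨0, hLpos⟩ with hυ_def
  have hυ : υ.emb.comp (algebraMap K Lf) = τ.emb := hυL ⟨0, hLpos⟩
  haveI := LocalField.charZero_adicCompletion u
  -- the blocks are de Rham at `u`, hence their label components are finite-dimensional
  have hVdR : ∀ i, (fontainePstAdicCompletion u ℓ hu).IsDeRhamFramed ((V i).toLocal u) := fun i => by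
    letI : Algebra E Lf := (ε i).toAlgebra
    have h₁ : (fontainePstAdicCompletion u ℓ hu).IsDeRhamFramed ((W.restrictField Lf).toLocal u) :=
      isDeRhamFramed_toLocal_restrictField DeRhamBaseChange_holds W hW u hu
    change (fontainePstAdicCompletion u ℓ hu).IsDeRhamFramed
      ((FramedRep.conj (W (t i)) (W.restrictField Lf)).comp (absGaloisRestrict Lf (u.adicCompletion Lf)))
    rw [FramedRep.conj_comp, PstWeilDeligneData.isDeRhamFramed_conj_iff]
    exact h₁
  have hfin : ∀ i, letI := (fontainePstAdicCompletion u ℓ hu).algebra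
      FiniteDimensional (PadicAlgCl ℓ) ((fontainePstAdicCompletion u ℓ hu).𝔅.labelD
        (FramedRep.toContinuousRep ((V i).toLocal u)) υ.toHom) := fun i => by
    letI := (fontainePstAdicCompletion u ℓ hu).algebra
    exact (fontainePst_finiteDimensional_labelD_and_finrank_eq
      (LocalField.valuation_adicCompletion_natCast_lt_one u ℓ hu) (hVdR i) υ).1
  -- (1) restriction to `Γ_L`, label by label:  `HT_{(v,τ)}(Ind W) = HT_{(u,υ)}((Ind W)|_{Γ_L})`
  have h1 : labelledHodgeTateWeightsAtLabel (W.induce K hd) v hv τ =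
      labelledHodgeTateWeightsAtLabel ((W.induce K hd).restrictField Lf) u hu υ :=
    (labelledHodgeTateWeightsAtLabel_restrictField_of_emb_comp_eq (W.induce K hd) τ υ hυ).symm
  -- (2) additivity over the blocks
  have h2 : labelledHodgeTateWeightsAtLabel ((W.induce K hd).restrictField Lf) u hu υ =
      ∑ i, (letI := (fontainePstAdicCompletion u ℓ hu).algebra
        (fontainePstAdicCompletion u ℓ hu).𝔅.labelledHodgeTateWeights
          (FramedRep.toContinuousRep ((V i).toLocal u)) υ.toHom) := by
    letI := (fontainePstAdicCompletion u ℓ hu).algebra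
    dsimp only [labelledHodgeTateWeightsAtLabel]
    rw [FramedGaloisRep.labelledHodgeTateWeightsAt_def]
    exact (fontainePstAdicCompletion u ℓ hu).𝔅.labelledHodgeTateWeights_blockDiagonal finProdFinEquiv
      (((W.induce K hd).restrictField Lf).toLocal u) (fun i => (V i).toLocal u) (hshape u) υ.toHom hfin
  -- (3) each block: frame invariance and label-wise restriction along `εᵢ`
  have h3 : ∀ i, ∃ (w : HeightOneSpectrum (𝓞 E)) (hw : ((ℓ : ℕ) : 𝓞 E) ∈ w.asIdeal)
      (σ : PinnedLabel ℓ w hw), σ.emb = υ.emb.comp (ε i) ∧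
      (letI := (fontainePstAdicCompletion u ℓ hu).algebra
       (fontainePstAdicCompletion u ℓ hu).𝔅.labelledHodgeTateWeights
         (FramedRep.toContinuousRep ((V i).toLocal u)) υ.toHom) =
        labelledHodgeTateWeightsAtLabel W w hw σ := fun i => by
    letI : Algebra E Lf := (ε i).toAlgebra
    refine ⟨u.under (𝓞 E), natCast_mem_under (F := E) hu, υ.below E, PinnedLabel.emb_below E υ, ?_⟩
    rw [← labelledHodgeTateWeightsAtLabel_restrictField_below W u hu υ]
    letI := (fontainePstAdicCompletion u ℓ hu).algebra
    dsimp only [labelledHodgeTateWeightsAtLabel]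
    rw [FramedGaloisRep.labelledHodgeTateWeightsAt_def]
    change (fontainePstAdicCompletion u ℓ hu).𝔅.labelledHodgeTateWeights (FramedRep.toContinuousRep
      ((FramedRep.conj (W (t i)) (W.restrictField Lf)).comp
        (absGaloisRestrict Lf (u.adicCompletion Lf)))) υ.toHom = _
    rw [FramedRep.conj_comp]
    exact PstWeilDeligneData.labelledHodgeTateWeights_conj_eq _ (W (t i)) _ υ.toHom
  choose w hw σ hσε hσHT using h3
  refine ⟨w, hw, σ, fun i => ?_, fun i j hij => hεinj ?_, ?_⟩
  · -- above `(v, τ)`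
    rw [hσε, RingHom.comp_assoc, hεK, hυ]
  · -- pairwise distinct embeddings
    have hij' : υ.emb.comp (ε i) = υ.emb.comp (ε j) := by
      have := hij
      dsimp only at this
      rwa [hσε, hσε] at this
    exact RingHom.ext fun x => υ.emb.injective (by
      simpa only [RingHom.comp_apply] using congrArg (fun f : E →+* PadicAlgCl ℓ => f x) hij')
  · -- the formula
    rw [h1, h2]
    exact Finset.sum_congr rfl fun i _ => hσHT i

end Literature.NumberTheory.PAdicHodge

end
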